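import Summits.Langlands.Langlands.Theses.OrdinaryPrimeTransport
import Literature.NumberTheory.Automorphic.DieulefaitBaseChangeGL2
import HarnessLib

/-!
# SKELETON — line `RealQuadraticBaseChangeGL2` for the crux `ReciprocityUpToIrreducibility`
# (item stmt-Langlands-14328; routes IrreducibilityBySelfDuality / OrdinaryPrimeTransport)
# forward generator G4 ladder-down, generation 16 (unit fwd2-ladder-Langlands-14328-g16)

Dial θ19 = the DEGREE `d₀ = [F₀:ℚ]` of the totally real BOTTOM field in NON-SOLVABLE base change for `GL₂`,
inside clause (B) of the top E = `ReciprocityUpToIrreducibility` at `n = 2` (clause (B) over the TOP field `F`,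
applied to restricted representations `ρ₀|Γ_F`).  Floor `d₀ = 1` = Dieulefait, JMPA 104 (2015) Thm. 1.2
(= Annals 176 (2012) Thm. 1.1 without local conditions): every classical newform of weight `≥ 2` base-changes to
EVERY totally real field — in-tree named fact `Literature.NumberTheory.Automorphic.Dieulefait2015_baseChange_GL2`
(vendored by this unit, p188171), `floor_one`.  THE RUNG `d₀ = 2`: base change of regular algebraic cuspidal
`π₀` of `GL₂` over REAL QUADRATIC fields `F₀` to every totally real extension `F ⊇ F₀` (no solvability) — open in
print ("for general extensions `L/F` the problem remains open … Dieulefait solved the base-change problem for `GL₂`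
with `F = ℚ`", arXiv:2604.05618 p. 3; Dieulefait–Pacetti, LMS LN 420 (2015) pp. 3, 15: for a GIVEN small real
quadratic field only "a finite computational check" is missing — their announced sequel never appeared).

The rung is DERIVED from two stubs along the architecture of the floor's proof ("killing ramification" [Di12b §4]
+ a safe chain in level one down to a base case [Dieulefait2015 §3, §5]):
`rung_of_killingRamification_of_levelOne : (LevelOneBaseChangeRQ → RealQuadraticBaseChangeGL2) → LevelOneBaseChangeRQ → rung`.

Six registered stubs; the kernel-checked composition `ReciprocityUpToIrreducibility_of : <stub₁-sig> → … → <stub₆-sig> → E`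
and `reciprocityUpToIrreducibility_of_stubs`.  TREE COPY concludes route OrdinaryPrimeTransport's decl
`Summit.Langlands.Langlands.Theses.OrdinaryPrimeTransport.ReciprocityUpToIrreducibility` (the shared item
stmt-Langlands-14328; the IrreducibilityBySelfDuality decl is the same text verbatim — as for g3–g15 the
IrreducibilityBySelfDuality Theses module does not elaborate on the crux-write host; the REGISTERED folder copy
concludes that decl BY NAME):

* `stub_floorFact : Dieulefait2015_baseChange_GL2` — the floor, a theorem IN PRINT vendored as a named fact (XL to
  discharge: the safe chain of [Dieulefait2015] §3 with its MAGMA / Stein-table steps);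
* `stub_levelOne : LevelOneBaseChangeRQ` — **THE OPEN CORE = BC9's cap-lifting input**: base change, to every totally
  real extension, of the EVERYWHERE-UNRAMIFIED (level one) regular algebraic cuspidal `π₀` of `GL₂` over real quadratic
  `F₀`.  Over `ℚ` the chain's terminal cells are `ℚ`-specific voids / CM-only spaces (`S_k(1) = 0` for `k < 12`,
  `S₂(49)`, `S₂(1452)`, Stein's tables); over `ℚ(√D)` level-one parallel-weight-2 newforms exist and are generically
  neither CM nor base change, so no uniform terminal cell is known (Dieulefait–Pacetti p. 3: "end up in some 'base
  case for modularity' over `F`, such as … Schoof" — field by field).  Decided sub-cell in print: rational level-one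
  parallel-weight-2 newforms = elliptic curves with everywhere good reduction (Freitas–Le Hung–Siksek + Dieulefait–Freitas
  2015 Thm. 3: base change of elliptic curves over real quadratic fields to totally real extensions);
* `stub_killingRamification : LevelOneBaseChangeRQ → RealQuadraticBaseChangeGL2` — "killing ramification" over a real
  quadratic bottom field: safe chains (ramification swapping at auxiliary primes split in `F`, micro good dihedral
  primes, each link an MLT over EVERY totally real `F` — in the tree `BLGGT2014_thm421_GL2_totallyReal`) reduce base
  change of any `π₀` to base change of level-one ones; every ingredient has a printed Hilbert analogue (plausibly L);
* `stub_higherDegrees : HigherDegrees` — the cells `d₀ ≥ 3`;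
* `stub_sectorMerge : (∀ d₀, NonsolvableBaseChangeGL2 d₀) → SectorGaloisToAutomorphic` — upgrade a.e.-Satake automorphy
  on the base-change sector to clause (B) of E verbatim (cuspidal, `L`-algebraic, `Corresponds` at every place, every `Rec`);
* `stub_offSector : OffSectorReciprocity` — E with clause (B) restricted OFF the sector (the honest complement).

Composition: `Rec` and clause (A) from `stub_offSector`; clause (B) by `by_cases InBCSector F ℓ ι ρ`.
Sorries ONLY inside the six `stub_*`.  Also recorded (sorry-free): `floor_one`, `family_zero`, `family_of`,
`RealQuadraticBaseChangeGL2_of_top : E → rung`, `nonsolvableBaseChangeGL2_of_langlands : Langlands → family d₀`.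
-/

noncomputable section

set_option linter.dupNamespace false

open scoped MatrixGroups Matrix NumberField Classical Polynomial
open Filter IsDedekindDomain Field Polynomial NumberField
open Literature.NumberTheory.Automorphic Literature.NumberTheory.GaloisRepresentations
open Literature.NumberTheory.PAdicHodge
open Summit.Langlands

namespace Summit.Langlands.Langlands.Cruxes.ReciprocityUpToIrreducibility.RealQuadraticBaseChangeGL2

/-! ## 1. The family, the rung, the level-one cell -/

/-- **The RUNG FAMILY, dial = degree `d₀` of the totally real bottom field** (verbatim as in `_onpath` / `_special`):
non-solvable base change for `GL₂` from totally real fields `F₀` of degree `d₀` — for every cuspidal `π₀` of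
`GL₂(𝔸_{F₀})` with a REGULAR `L`-algebraic infinity type, every `ι`, every framed `ρ₀` attached to `π₀` at almost
all places and every totally real extension `F ⊇ F₀` (any `F₀`-algebra structure; no solvability): if `ρ₀|Γ_F` is
irreducible, a.e. unramified and de Rham above `ℓ` for Fontaine's pinned datum, it is automorphic (`IsAutomorphicAE`). -/
def NonsolvableBaseChangeGL2 (d₀ : ℕ) : Prop :=
  ∀ (F₀ : Type) [Field F₀] [NumberField F₀] [IsTotallyReal F₀], Module.finrank ℚ F₀ = d₀ →
    ∀ (hcpt₀ : isCompact_glFiniteIntegralLevel 2 F₀) (π₀ : CuspidalAutomorphicRepData 2 F₀ hcpt₀),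
      (∃ T : InfinityType F₀ 2, π₀.1.HasInfinityType T ∧ T.IsRegular ∧ T.IsLAlgebraic) →
      ∀ (ℓ : ℕ) [Fact ℓ.Prime] (ι : PadicAlgCl ℓ ≃+* ℂ) (ρ₀ : FramedGaloisRep F₀ (PadicAlgCl ℓ) 2),
        SatakeFrobCompatibleAE ι π₀.1 ρ₀ →
        ∀ (F : Type) [Field F] [NumberField F] [Algebra F₀ F] [IsTotallyReal F],
          (ρ₀.restrictField F).toGaloisRep.IsIrreducible →
          (∀ᶠ w : HeightOneSpectrum (𝓞 F) in cofinite, (ρ₀.restrictField F).IsUnramifiedAt w) →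
          (∀ (w : HeightOneSpectrum (𝓞 F)) (hw : ((ℓ : ℕ) : 𝓞 F) ∈ w.asIdeal),
              (fontainePstAdicCompletion w ℓ hw).IsDeRhamFramed ((ρ₀.restrictField F).toLocal w)) →
          ∀ (hcpt : isCompact_glFiniteIntegralLevel 2 F), IsAutomorphicAE ι hcpt (ρ₀.restrictField F)

/-- **THE RUNG (θ19 = 2)**: non-solvable base change for `GL₂` from REAL QUADRATIC bottom fields. -/
def RealQuadraticBaseChangeGL2 : Prop := NonsolvableBaseChangeGL2 2

/-- **The LEVEL-ONE cell of the family** (the chain's terminal input): the same statement for `π₀` UNRAMIFIED AT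
EVERY FINITE PLACE of `F₀`. -/
def NonsolvableBaseChangeGL2LevelOne (d₀ : ℕ) : Prop :=
  ∀ (F₀ : Type) [Field F₀] [NumberField F₀] [IsTotallyReal F₀], Module.finrank ℚ F₀ = d₀ →
    ∀ (hcpt₀ : isCompact_glFiniteIntegralLevel 2 F₀) (π₀ : CuspidalAutomorphicRepData 2 F₀ hcpt₀),
      (∃ T : InfinityType F₀ 2, π₀.1.HasInfinityType T ∧ T.IsRegular ∧ T.IsLAlgebraic) →
      (∀ v : HeightOneSpectrum (𝓞 F₀), π₀.1.IsUnramifiedAt v) →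
      ∀ (ℓ : ℕ) [Fact ℓ.Prime] (ι : PadicAlgCl ℓ ≃+* ℂ) (ρ₀ : FramedGaloisRep F₀ (PadicAlgCl ℓ) 2),
        SatakeFrobCompatibleAE ι π₀.1 ρ₀ →
        ∀ (F : Type) [Field F] [NumberField F] [Algebra F₀ F] [IsTotallyReal F],
          (ρ₀.restrictField F).toGaloisRep.IsIrreducible →
          (∀ᶠ w : HeightOneSpectrum (𝓞 F) in cofinite, (ρ₀.restrictField F).IsUnramifiedAt w) →
          (∀ (w : HeightOneSpectrum (𝓞 F)) (hw : ((ℓ : ℕ) : 𝓞 F) ∈ w.asIdeal),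
              (fontainePstAdicCompletion w ℓ hw).IsDeRhamFramed ((ρ₀.restrictField F).toLocal w)) →
          ∀ (hcpt : isCompact_glFiniteIntegralLevel 2 F), IsAutomorphicAE ι hcpt (ρ₀.restrictField F)

/-- **THE OPEN CORE of the rung**: base change of LEVEL-ONE regular algebraic cuspidal `π₀` of `GL₂` over real
quadratic fields to every totally real extension. -/
def LevelOneBaseChangeRQ : Prop := NonsolvableBaseChangeGL2LevelOne 2

/-- The cells `d₀ ≥ 3` of the family. -/
def HigherDegrees : Prop := ∀ d₀ : ℕ, 3 ≤ d₀ → NonsolvableBaseChangeGL2 d₀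

/-! ## 2. Floor, vacuous cell, the rung from its two stubs, every degree (sorry-free) -/

/-- **F3: the family at `d₀ = 1` IS the floor** (Dieulefait 2015 Thm. 1.2, in-tree named fact). -/
theorem floor_one (h : Dieulefait2015_baseChange_GL2) : NonsolvableBaseChangeGL2 1 := by
  intro F₀ _ _ _ hd hcpt₀ π₀ hreg ℓ _ ι ρ₀ hcomp F _ _ _ _ _hirr _hunr _hdR hcpt
  exact h F₀ hd hcpt₀ π₀ hreg ℓ ι ρ₀ hcomp F hcpt

/-- The degree-zero member is vacuous. -/
theorem family_zero : NonsolvableBaseChangeGL2 0 := by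
  intro F₀ _ _ _ hd
  exact absurd hd (Module.finrank_pos (R := ℚ) (M := F₀)).ne'

/-- The level-one cell is a special case of the family (informational). -/
theorem levelOne_of_family (d₀ : ℕ) (h : NonsolvableBaseChangeGL2 d₀) : NonsolvableBaseChangeGL2LevelOne d₀ := by
  intro F₀ _ _ _ hd hcpt₀ π₀ hreg _hlev ℓ _ ι ρ₀ hcomp F _ _ _ _ hirr hunr hdR hcpt
  exact h F₀ hd hcpt₀ π₀ hreg ℓ ι ρ₀ hcomp F hirr hunr hdR hcpt

/-- **The rung from its two stubs** ("killing ramification" + the level-one cell). -/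
theorem rung_of_killingRamification_of_levelOne (hK : LevelOneBaseChangeRQ → RealQuadraticBaseChangeGL2)
    (hL : LevelOneBaseChangeRQ) : RealQuadraticBaseChangeGL2 :=
  hK hL

/-- **Every degree** from the floor fact, the two rung stubs and the higher cells. -/
theorem family_of (hfloor : Dieulefait2015_baseChange_GL2)
    (hK : LevelOneBaseChangeRQ → RealQuadraticBaseChangeGL2) (hL : LevelOneBaseChangeRQ)
    (hhigh : HigherDegrees) (d₀ : ℕ) : NonsolvableBaseChangeGL2 d₀ := by
  rcases Nat.lt_or_ge d₀ 3 with h | h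
  · interval_cases d₀
    · exact family_zero
    · exact floor_one hfloor
    · exact rung_of_killingRamification_of_levelOne hK hL
  · exact hhigh d₀ h

/-! ## 3. The base-change sector of clause (B), the merge target, the off-sector complement -/

/-- **The base-change sector of clause (B)** at `(F, ℓ, ι, ρ)`: `F` is totally real and `ρ : Γ_F → GL_n(ℚ̄_ℓ)` has
every Frobenius characteristic polynomial of `ρ₀|Γ_F` for some `ρ₀` over a totally real subfield `F₀ ⊆ F` attached
(via `ι`) to a regular `L`-algebraic cuspidal `π₀` of `GL₂(𝔸_{F₀})`, with `ρ₀|Γ_F` irreducible, a.e. unramified and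
de Rham above `ℓ` (so `ρ` "is" `ρ₀|Γ_F`; no cast on `n` is needed since `HasFrobCharpolyAt` takes any polynomial). -/
def InBCSector (F : Type) [Field F] [NumberField F] (ℓ : ℕ) [Fact ℓ.Prime] (ι : PadicAlgCl ℓ ≃+* ℂ) {n : ℕ}
    (ρ : FramedGaloisRep F (PadicAlgCl ℓ) n) : Prop :=
  IsTotallyReal F ∧
    ∃ (F₀ : Type) (_ : Field F₀) (_ : NumberField F₀) (_ : IsTotallyReal F₀) (_ : Algebra F₀ F)
      (hcpt₀ : isCompact_glFiniteIntegralLevel 2 F₀) (π₀ : CuspidalAutomorphicRepData 2 F₀ hcpt₀)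
      (ρ₀ : FramedGaloisRep F₀ (PadicAlgCl ℓ) 2),
      (∃ T : InfinityType F₀ 2, π₀.1.HasInfinityType T ∧ T.IsRegular ∧ T.IsLAlgebraic) ∧
      SatakeFrobCompatibleAE ι π₀.1 ρ₀ ∧
      (ρ₀.restrictField F).toGaloisRep.IsIrreducible ∧
      (∀ᶠ w : HeightOneSpectrum (𝓞 F) in cofinite, (ρ₀.restrictField F).IsUnramifiedAt w) ∧
      (∀ (w : HeightOneSpectrum (𝓞 F)) (hw : ((ℓ : ℕ) : 𝓞 F) ∈ w.asIdeal),
          (fontainePstAdicCompletion w ℓ hw).IsDeRhamFramed ((ρ₀.restrictField F).toLocal w)) ∧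
      ∀ (w : HeightOneSpectrum (𝓞 F)) (P : Polynomial (PadicAlgCl ℓ)),
        (ρ₀.restrictField F).HasFrobCharpolyAt w P → ρ.HasFrobCharpolyAt w P

/-- **Merge target**: clause (B) of E VERBATIM (cuspidal, `L`-algebraic, `Corresponds Rec ι π ρ` — a.e. Satake AND
`LocalGlobalCompatibleAt` at every finite place) for EVERY reciprocity datum `Rec`, on the base-change sector. -/
def SectorGaloisToAutomorphic : Prop :=
  ∀ (F : Type) [Field F] [NumberField F] (Rec : ReciprocityData F) (n : ℕ), 0 < n →
    ∀ (hcpt : isCompact_glFiniteIntegralLevel n F) (ℓ : ℕ) [Fact ℓ.Prime] (ι : PadicAlgCl ℓ ≃+* ℂ)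
      (ρ : FramedGaloisRep F (PadicAlgCl ℓ) n),
      ρ.toGaloisRep.IsIrreducible → IsGeometricFramed Rec ρ → InBCSector F ℓ ι ρ →
        ∃ π : CuspidalAutomorphicRepData n F hcpt, π.1.IsLAlgebraic ∧ Corresponds Rec ι π.1 ρ

/-- **The off-sector complement**: E (`ReciprocityUpToIrreducibility`) with clause (A) entire and clause (B)
restricted to `ρ` NOT in the base-change sector. -/
def OffSectorReciprocity : Prop :=
  ∀ (F : Type) [Field F] [NumberField F], ∃ Rec : ReciprocityData F, ∀ n : ℕ, 0 < n →
    ∀ hcpt : isCompact_glFiniteIntegralLevel n F,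
      (∀ π : CuspidalAutomorphicRepData n F hcpt, π.1.IsLAlgebraic →
        ∀ (ℓ : ℕ) [Fact ℓ.Prime] (ι : PadicAlgCl ℓ ≃+* ℂ),
          ∃ ρ : FramedGaloisRep F (PadicAlgCl ℓ) n, IsGeometricFramed Rec ρ ∧ Corresponds Rec ι π.1 ρ) ∧
      (∀ (ℓ : ℕ) [Fact ℓ.Prime] (ι : PadicAlgCl ℓ ≃+* ℂ) (ρ : FramedGaloisRep F (PadicAlgCl ℓ) n),
        ρ.toGaloisRep.IsIrreducible → IsGeometricFramed Rec ρ → ¬ InBCSector F ℓ ι ρ →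
          ∃ π : CuspidalAutomorphicRepData n F hcpt, π.1.IsLAlgebraic ∧ Corresponds Rec ι π.1 ρ)

/-! ## 4. The six registered stubs -/

/-- The floor: Dieulefait 2015 Thm. 1.2, a theorem in print vendored as a named fact (floor debt).
[cite: Dieulefait2015, Thm. 1.2] -/
theorem stub_floorFact : Dieulefait2015_baseChange_GL2 := by
  sorry

/-- **THE OPEN CORE / cap-lifting input**: base change of LEVEL-ONE regular algebraic cuspidal `π₀` of `GL₂` over
real quadratic fields to every totally real extension.  OPEN (no uniform terminal base case over `ℚ(√D)`). -/
theorem stub_levelOne : LevelOneBaseChangeRQ := by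
  sorry

/-- **Killing ramification over a real quadratic bottom field**: safe chains (ramification swapping, micro good
dihedral primes, links = MLTs over every totally real `F`) reduce base change of any regular algebraic `π₀` over
`ℚ(√D)` to the level-one cell.  Plausibly L (every ingredient has a printed Hilbert analogue; [Di12b §4],
[DieulefaitPacetti2015 p. 15]). -/
theorem stub_killingRamification : LevelOneBaseChangeRQ → RealQuadraticBaseChangeGL2 := by
  sorry

/-- The cells `d₀ ≥ 3` of the family (open). -/
theorem stub_higherDegrees : HigherDegrees := by
  sorry

/-- Sector merge: from a.e.-Satake automorphy on the whole base-change sector (all degrees) to clause (B) of E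
verbatim on the sector, for every `Rec` (strong multiplicity one ⇒ the cuspidal `π`; local–global compatibility at
every finite place, the `v ∣ ℓ` clause against the pinned Fontaine datum). -/
theorem stub_sectorMerge : (∀ d₀ : ℕ, NonsolvableBaseChangeGL2 d₀) → SectorGaloisToAutomorphic := by
  sorry

/-- The honest complement: E off the base-change sector. -/
theorem stub_offSector : OffSectorReciprocity := by
  sorry

/-! ## 5. Composition (no sorry below this line) -/

/-- **COMPOSITION — the crux BY NAME from the six stub statements.**  `Rec` and clause (A) come from the off-sector
statement; clause (B) is a case split on the base-change sector.  Conclusion spelled as the OrdinaryPrimeTransport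
copy of the shared decl (same text); in the registered folder copy the item's IrreducibilityBySelfDuality decl is
concluded BY NAME. -/
theorem ReciprocityUpToIrreducibility_of :
    Dieulefait2015_baseChange_GL2 → LevelOneBaseChangeRQ → (LevelOneBaseChangeRQ → RealQuadraticBaseChangeGL2) →
    HigherDegrees → ((∀ d₀ : ℕ, NonsolvableBaseChangeGL2 d₀) → SectorGaloisToAutomorphic) →
    OffSectorReciprocity →
    Summit.Langlands.Langlands.Theses.OrdinaryPrimeTransport.ReciprocityUpToIrreducibility := by
  intro hfloor hL hK hhigh hmerge hoff F _ _
  obtain ⟨Rec, hall⟩ := hoff F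
  refine ⟨Rec, fun n hn hcpt => ⟨(hall n hn hcpt).1, ?_⟩⟩
  intro ℓ _ ι ρ hirr hgeo
  by_cases hsec : InBCSector F ℓ ι ρ
  · exact hmerge (family_of hfloor hK hL hhigh) F Rec n hn hcpt ℓ ι ρ hirr hgeo hsec
  · exact (hall n hn hcpt).2 ℓ ι ρ hirr hgeo hsec

/-- **THE REGISTERED SKELETON THEOREM** — the item's decl from the six registered stubs (audit: proof-of-item modulo
the six sorries). -/
theorem reciprocityUpToIrreducibility_of_stubs :
    Summit.Langlands.Langlands.Theses.OrdinaryPrimeTransport.ReciprocityUpToIrreducibility :=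
  ReciprocityUpToIrreducibility_of stub_floorFact stub_levelOne stub_killingRamification stub_higherDegrees
    stub_sectorMerge stub_offSector

/-! ## 6. The rung is a consequence of the top and of the summit (sorry-free) -/

/-- `E → NonsolvableBaseChangeGL2 d₀` for every `d₀` (clause (B) of E over the top field `F` for its own `Rec`). -/
theorem nonsolvableBaseChangeGL2_of_top (d₀ : ℕ)
    (hE : Summit.Langlands.Langlands.Theses.OrdinaryPrimeTransport.ReciprocityUpToIrreducibility) :
    NonsolvableBaseChangeGL2 d₀ := by
  intro F₀ _ _ _ _hd hcpt₀ π₀ _hreg ℓ _ ι ρ₀ _hcomp F _ _ _ _ hirr hunr hdR hcpt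
  obtain ⟨Rec, hall⟩ := hE F
  have hB : GaloisToAutomorphic 2 Rec hcpt := (hall 2 two_pos hcpt).2
  have hgeo : IsGeometricFramed Rec (ρ₀.restrictField F) := ⟨hunr, fun w hw => hdR w hw⟩
  obtain ⟨π, hLalg, hcorr⟩ := hB ℓ ι (ρ₀.restrictField F) hirr hgeo
  exact ⟨π, hLalg, hcorr.1⟩

/-- `E → rung`. -/
theorem RealQuadraticBaseChangeGL2_of_top
    (hE : Summit.Langlands.Langlands.Theses.OrdinaryPrimeTransport.ReciprocityUpToIrreducibility) :
    RealQuadraticBaseChangeGL2 :=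
  nonsolvableBaseChangeGL2_of_top 2 hE

/-- `Langlands → NonsolvableBaseChangeGL2 d₀` for every `d₀` (the F4 on-path lemma, also in `_onpath`). -/
theorem nonsolvableBaseChangeGL2_of_langlands (d₀ : ℕ) (hL : _root_.Langlands) :
    NonsolvableBaseChangeGL2 d₀ := by
  intro F₀ _ _ _ _hd hcpt₀ π₀ _hreg ℓ _ ι ρ₀ _hcomp F _ _ _ _ hirr hunr hdR hcpt
  obtain ⟨⟨Rec⟩, hall⟩ := hL F
  have hB : GaloisToAutomorphic 2 Rec hcpt := (hall Rec 2 (by norm_num) hcpt).2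
  have hgeo : IsGeometricFramed Rec (ρ₀.restrictField F) := ⟨hunr, fun w hw => hdR w hw⟩
  obtain ⟨π, hLalg, hcorr⟩ := hB ℓ ι (ρ₀.restrictField F) hirr hgeo
  exact ⟨π, hLalg, hcorr.1⟩

end Summit.Langlands.Langlands.Cruxes.ReciprocityUpToIrreducibility.RealQuadraticBaseChangeGL2

end
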